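import Mathlib
import Summits.Ventures.PercRepro2.CrossAPrimeTwoRoutesTools
import Summits.Ventures.PercRepro2.CrossAPrimeAvoidCrux

/-!
# The two-route class: the sign of `crossA′so` when `G − a₂` has exactly two `a₁`–`v` paths
(blind cell PercRepro2, p5 g35; S4 §2.4 (s) addendum 33, the hard case `o ∈ V₁`, `b ∈ V₂`; the
tools are in `CrossAPrimeTwoRoutesTools`)

Two edge-disjoint paths `π₁`, `π₂` from `a₁` to `v` with vertex sets `V₁`, `V₂` (without `a₁`),
`o ∈ V₁`, `b ∈ V₂`, and the ROUTE DICTIONARY on `Q = {a₂ ↮ a₁}`: `a₁ ↔ v` iff `π₁` or `π₂` is open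
(`hroute`).  Then the route masses collapse (`Dv = 0`, `xv = p₂·x_{2̄}`, `yv = p₁·y_{1̄}` with
`x_{2̄} = P(Q, o ∈ K, K ∩ V₂ = ∅)`, `p_i = ∏_{e ∈ π_i} p e`), and the crux at the admissible
constant `c = p₁ + p₂ − p₁p₂ ≤ π` reads `c·x·y − p₁·x·y_{1̄} − p₂·y·x_{2̄} ≥ 0`.  The new
ingredient is the **tail bound** (`tail_bound`): for a tail `τ` of `π₂` joining `b` to `v`
(`htail`), under the absorption hypothesis `hsep` (from `Q`, forcing `τ` open can only absorb
`a₁` through `π₁`, i.e. only if `π₁` is open — asked only on `Q ∩ {b ∈ K}`), with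
`γ = ∏_{e ∈ τ} p e`,

  `P(Q, b ∈ K, v ∈ K) ≥ γ·(P(Q, b ∈ K) − p₁·P(Q, b ∈ K, v ∉ K))`,

proved by forcing the tail open: `P(Q, b ∈ K, v ∈ K) ≥ P(A′ ∩ {τ open}) = γ·P(A′)` for
`A′ = {ω : ω[τ ↦ open] ∈ Q ∩ bH ∩ vH}`, which contains `Q ∩ bH` minus the absorption event, and
the absorption event has probability `≤ p₁·P(Q, b ∈ K, v ∉ K)` (it forces `π₁` open, which keeps
`K` off `V₁`, where `π₁`'s edges are free).  The algebra (`two_routes_algebra`): with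
`d_b = P(Q, b ∈ K, v ∉ K)`, the tail bounds give `d_b(1 − p₁p₂) ≤ y(1 − p₂)` (via
`γ_b ≥ p₂`) and symmetrically, whence `p₁·x·d_b + p₂·y·d_o ≤ (p₁ + p₂ − p₁p₂)·x·y`.
Own work; standard axioms.
-/

namespace Summit.Ventures.PercRepro2

open LeafRowPendantRootSO CrossAPrimeA2Route

namespace CrossAPrimeTwoRoutes

section Tail

variable {V : Type*} {E : Type*} [Fintype E] [DecidableEq E] [DecidableEq V] {R : Type*} [Field R]
  [LinearOrder R] [IsStrictOrderedRing R]
variable {ends : E → Sym2 V}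

/-- **The tail bound.**  `τ` joins `b` to `v` when open (`htail`); from `Q ∩ {b ∈ K}`, forcing `τ`
open can absorb `a₁` only if `π₁` is open (`hsep`); `π₁` lives on `insert a₁ V₁`, connects `a₁` to `V₁`,
and `v ∈ V₁`.  Then, with `γ = ∏_{τ} p e` and `p₁ = ∏_{π₁} p e`,
`P(Q, b ∈ K, v ∈ K) ≥ γ·(P(Q, b ∈ K) − p₁·P(Q, b ∈ K, v ∉ K))`. -/
theorem tail_bound (p : E → R) (hp : IsProbVec p) {τ π₁ : Finset E} {a₁ a₂ v b : V}
    {V₁ : Finset V}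
    (hπ₁ : ∀ e ∈ π₁, ∀ x, x ∈ ends e → x = a₁ ∨ x ∈ V₁)
    (hconn₁ : ∀ ω ∈ allOpen π₁, ∀ x ∈ V₁, Conn ends ω a₁ x) (hv₁ : v ∈ V₁)
    (htail : ∀ ω ∈ allOpen τ, Conn ends ω b v)
    (hsep : ∀ ω, ω ∈ avoidAll ends a₂ {a₁} → ω ∈ connEvent ends a₂ b →
      Conn ends (forceOpen τ ω) a₂ a₁ → ω ∈ allOpen π₁) :
    (∏ e ∈ τ, p e) *
        (prob p (avoidAll ends a₂ {a₁} ∩ connEvent ends a₂ b) -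
          (∏ e ∈ π₁, p e) *
            prob p (avoidAll ends a₂ {a₁} ∩ connEvent ends a₂ b ∩ (connEvent ends a₂ v)ᶜ)) ≤
      prob p (avoidAll ends a₂ {a₁} ∩ connEvent ends a₂ b ∩ connEvent ends a₂ v) := by
  classical
  set Q := avoidAll ends a₂ {a₁} with hQ
  set B := connEvent ends a₂ b
  set Vv := connEvent ends a₂ v
  -- the forced event
  set A' : Set (Config E) := {ω | forceOpen τ ω ∈ Q ∩ B ∩ Vv} with hA'
  have hA'dep : DependsOn (· ∈ A') ((↑τ : Set E)ᶜ) := by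
    intro ω ω' h
    simp only [hA', Set.mem_setOf_eq]
    rw [forceOpen_eq_of_eqOn h]
  -- (1) `P(Q B V) ≥ P(A' ∩ {τ open}) = γ·P(A')`
  have h1 : prob p (A' ∩ allOpen τ) ≤ prob p (Q ∩ B ∩ Vv) := by
    refine prob_mono hp fun ω hω => ?_
    have := hω.1
    simp only [hA', Set.mem_setOf_eq] at this
    rwa [forceOpen_eq_of_mem_allOpen hω.2] at this
  have h2 : prob p (A' ∩ allOpen τ) = prob p A' * ∏ e ∈ τ, p e :=
    prob_inter_allOpen p τ hA'dep
  -- (2) `A' ⊇ (Q ∩ B) ∖ Abs`, `Abs ∩ Q ⊆ {π₁ open}`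
  set Abs : Set (Config E) := {ω | Conn ends (forceOpen τ ω) a₂ a₁} with hAbs
  have h3 : Q ∩ B ∩ Absᶜ ⊆ A' := by
    intro ω hω
    simp only [hA', Set.mem_setOf_eq, Set.mem_inter_iff]
    have hle := le_forceOpen τ ω
    refine ⟨⟨?_, conn_mono hle hω.1.2⟩, ?_⟩
    · intro x hx hc
      rw [Finset.mem_singleton] at hx
      rw [hx] at hc
      exact hω.2 hc
    · exact conn_trans (conn_mono hle hω.1.2) (htail _ (forceOpen_mem_allOpen τ ω))
  have h4 : Q ∩ B ∩ Abs ⊆ Q ∩ B ∩ allOpen π₁ := by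
    intro ω hω
    exact ⟨hω.1, hsep ω hω.1.1 hω.1.2 hω.2⟩
  -- the absorption mass is at most `p₁ · P(Q, b ∈ K, v ∉ K)`
  have h5 : prob p (Q ∩ B ∩ allOpen π₁) ≤
      (∏ e ∈ π₁, p e) * prob p (Q ∩ B ∩ Vvᶜ) := by
    rw [prob_Q_conn_allOpen p hπ₁ hconn₁ a₂ b]
    refine mul_le_mul_of_nonneg_left (prob_mono hp fun ω hω => ?_) (Finset.prod_nonneg fun e _ => hp.nonneg e)
    refine ⟨⟨fun x hx => hω.1 x (by rw [Finset.mem_singleton] at hx; rw [hx]; exact Finset.mem_insert_self a₁ V₁), hω.2⟩, ?_⟩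
    exact hω.1 v (Finset.mem_insert_of_mem hv₁)
  -- assemble
  have hsplit := prob_inter_add_prob_inter_compl p (Q ∩ B) Abs
  have hA'ge : prob p (Q ∩ B ∩ Absᶜ) ≤ prob p A' := prob_mono hp h3
  have hAbs_le : prob p (Q ∩ B ∩ Abs) ≤ (∏ e ∈ π₁, p e) * prob p (Q ∩ B ∩ Vvᶜ) :=
    (prob_mono hp h4).trans h5
  have hγ : 0 ≤ ∏ e ∈ τ, p e := Finset.prod_nonneg fun e _ => hp.nonneg e
  have key : prob p (Q ∩ B) - (∏ e ∈ π₁, p e) * prob p (Q ∩ B ∩ Vvᶜ) ≤ prob p A' := by linarith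
  calc (∏ e ∈ τ, p e) * (prob p (Q ∩ B) - (∏ e ∈ π₁, p e) * prob p (Q ∩ B ∩ Vvᶜ))
      ≤ (∏ e ∈ τ, p e) * prob p A' := mul_le_mul_of_nonneg_left key hγ
    _ = prob p (A' ∩ allOpen τ) := by rw [h2, mul_comm]
    _ ≤ prob p (Q ∩ B ∩ Vv) := h1

end Tail



section Main

variable {V : Type*} {E : Type*} [Fintype E] [DecidableEq E] [DecidableEq V] {R : Type*} [Field R]
  [LinearOrder R] [IsStrictOrderedRing R]
variable {ends : E → Sym2 V}

/-- **The two-route class, hard case `o ∈ V₁`, `b ∈ V₂`: the sign of `crossA′so`.**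
Hypotheses: `π₁`, `π₂` edge-disjoint, living on `insert a₁ V₁` / `insert a₁ V₂`, each connecting
`a₁` to all of its vertices when open, `v ∈ V₁ ∩ V₂`, `o ∈ V₁`, `b ∈ V₂`; the route dictionary on
`Q` (`hroute`); tails `τ₁ ⊆ π₁` from `o` to `v` and `τ₂ ⊆ π₂` from `b` to `v` (`htail`), and the
absorption hypotheses (`hsep`: from `Q ∩ {o ∈ K}` resp. `Q ∩ {b ∈ K}`, forcing the tail open
reaches `a₁` only through the other route, fully open — the structural content of «exactly two
paths»: a new vertex reached from `v` lies on the other route, and `a₁` is reached only along it). -/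
theorem crossA'so_nonneg_of_twoRoutes (p : E → R) (hp : IsProbVec p) {π₁ π₂ τ₁ τ₂ : Finset E}
    {V₁ V₂ : Finset V} {o a₁ a₂ v b : V}
    (hd : Disjoint π₁ π₂)
    (hπ₁ : ∀ e ∈ π₁, ∀ x, x ∈ ends e → x = a₁ ∨ x ∈ V₁)
    (hπ₂ : ∀ e ∈ π₂, ∀ x, x ∈ ends e → x = a₁ ∨ x ∈ V₂)
    (hconn₁ : ∀ ω ∈ allOpen π₁, ∀ x ∈ V₁, Conn ends ω a₁ x)
    (hconn₂ : ∀ ω ∈ allOpen π₂, ∀ x ∈ V₂, Conn ends ω a₁ x)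
    (hv₁ : v ∈ V₁) (hv₂ : v ∈ V₂) (ho : o ∈ V₁) (hb : b ∈ V₂)
    (hroute : ∀ ω ∈ avoidAll ends a₂ {a₁},
      ω ∈ connEvent ends a₁ v ↔ ω ∈ allOpen π₁ ∪ allOpen π₂)
    (hτ₁ : τ₁ ⊆ π₁) (hτ₂ : τ₂ ⊆ π₂)
    (htail₁ : ∀ ω ∈ allOpen τ₁, Conn ends ω o v) (htail₂ : ∀ ω ∈ allOpen τ₂, Conn ends ω b v)
    (hsep₁ : ∀ ω, ω ∈ avoidAll ends a₂ {a₁} → ω ∈ connEvent ends a₂ o →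
      Conn ends (forceOpen τ₁ ω) a₂ a₁ → ω ∈ allOpen π₂)
    (hsep₂ : ∀ ω, ω ∈ avoidAll ends a₂ {a₁} → ω ∈ connEvent ends a₂ b →
      Conn ends (forceOpen τ₂ ω) a₂ a₁ → ω ∈ allOpen π₁) :
    0 ≤ crossA'so p ends o a₁ a₂ v b := by
  classical
  set p₁ := ∏ e ∈ π₁, p e with hp₁def
  set p₂ := ∏ e ∈ π₂, p e with hp₂def
  have hp₁0 : 0 ≤ p₁ := Finset.prod_nonneg fun e _ => hp.nonneg e
  have hp₂0 : 0 ≤ p₂ := Finset.prod_nonneg fun e _ => hp.nonneg e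
  have hp₁1 : p₁ ≤ 1 := Finset.prod_le_one (fun e _ => hp.nonneg e) (fun e _ => hp.le_one e)
  have hp₂1 : p₂ ≤ 1 := Finset.prod_le_one (fun e _ => hp.nonneg e) (fun e _ => hp.le_one e)
  -- the constant `c = p₁ + p₂ − p₁p₂ ≤ π`
  have hc : p₁ + p₂ - p₁ * p₂ ≤ prob p (connEvent ends a₁ v) := by
    rw [← prob_allOpen_union p hd]
    refine prob_mono hp fun ω hω => ?_
    rcases hω with h | h
    · exact hconn₁ ω h v hv₁
    · exact hconn₂ ω h v hv₂
  refine crossA'so_nonneg_of_crossC hp o a₁ a₂ v b hc ?_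
  -- the masses
  set Q := avoidAll ends a₂ {a₁} with hQ
  set oH := connEvent ends a₂ o
  set bH := connEvent ends a₂ b
  set vH := connEvent ends a₂ v
  set L := connEvent ends a₁ v
  -- `Dv = 0`
  have hDv : prob p (Q ∩ (L ∩ (oH ∩ bH))) = 0 := by
    have : Q ∩ (L ∩ (oH ∩ bH)) = ∅ := by
      ext ω
      simp only [Set.mem_inter_iff, Set.mem_empty_iff_false, iff_false, not_and]
      intro hQω hL hoK hbK
      rcases (hroute ω hQω).1 hL with h | h
      · exact not_allOpen_of_mem hconn₁ ho hQω hoK h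
      · exact not_allOpen_of_mem hconn₂ hb hQω hbK h
    rw [this, prob_empty]
  -- `xv = p₂ · x₂`
  have hxv : prob p (Q ∩ (L ∩ oH)) =
      p₂ * prob p (avoidAll ends a₂ (insert a₁ V₂) ∩ oH) := by
    have e1 : Q ∩ (L ∩ oH) = Q ∩ oH ∩ allOpen π₂ := by
      ext ω
      simp only [Set.mem_inter_iff]
      constructor
      · rintro ⟨hQω, hL, hoK⟩
        refine ⟨⟨hQω, hoK⟩, ?_⟩
        rcases (hroute ω hQω).1 hL with h | h
        · exact absurd h (not_allOpen_of_mem hconn₁ ho hQω hoK)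
        · exact h
      · rintro ⟨⟨hQω, hoK⟩, hπ⟩
        exact ⟨hQω, (hroute ω hQω).2 (Or.inr hπ), hoK⟩
    rw [e1]
    exact prob_Q_conn_allOpen p hπ₂ hconn₂ a₂ o
  -- `yv = p₁ · y₁`
  have hyv : prob p (Q ∩ (L ∩ bH)) =
      p₁ * prob p (avoidAll ends a₂ (insert a₁ V₁) ∩ bH) := by
    have e1 : Q ∩ (L ∩ bH) = Q ∩ bH ∩ allOpen π₁ := by
      ext ω
      simp only [Set.mem_inter_iff]
      constructor
      · rintro ⟨hQω, hL, hbK⟩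
        refine ⟨⟨hQω, hbK⟩, ?_⟩
        rcases (hroute ω hQω).1 hL with h | h
        · exact h
        · exact absurd h (not_allOpen_of_mem hconn₂ hb hQω hbK)
      · rintro ⟨⟨hQω, hbK⟩, hπ⟩
        exact ⟨hQω, (hroute ω hQω).2 (Or.inl hπ), hbK⟩
    rw [e1]
    exact prob_Q_conn_allOpen p hπ₁ hconn₁ a₂ b
  -- names
  set x := prob p (Q ∩ oH) with hxdef
  set y := prob p (Q ∩ bH) with hydef
  set x₂ := prob p (avoidAll ends a₂ (insert a₁ V₂) ∩ oH) with hx₂def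
  set y₁ := prob p (avoidAll ends a₂ (insert a₁ V₁) ∩ bH) with hy₁def
  set d_b := prob p (Q ∩ bH ∩ vHᶜ) with hdbdef
  set d_o := prob p (Q ∩ oH ∩ vHᶜ) with hdodef
  -- `y₁ ≤ d_b`, `x₂ ≤ d_o`
  have hy₁ : y₁ ≤ d_b := by
    refine prob_mono hp fun ω hω => ?_
    refine ⟨⟨fun z hz => hω.1 z (by rw [Finset.mem_singleton] at hz; rw [hz]; exact Finset.mem_insert_self a₁ V₁), hω.2⟩, ?_⟩
    exact hω.1 v (Finset.mem_insert_of_mem hv₁)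
  have hx₂ : x₂ ≤ d_o := by
    refine prob_mono hp fun ω hω => ?_
    refine ⟨⟨fun z hz => hω.1 z (by rw [Finset.mem_singleton] at hz; rw [hz]; exact Finset.mem_insert_self a₁ V₂), hω.2⟩, ?_⟩
    exact hω.1 v (Finset.mem_insert_of_mem hv₂)
  -- the tail bounds, in the `d`-form
  have hγ₂ : p₂ ≤ ∏ e ∈ τ₂, p e := by
    rw [hp₂def, ← Finset.prod_sdiff hτ₂]
    have h1 : ∏ e ∈ π₂ \ τ₂, p e ≤ 1 :=
      Finset.prod_le_one (fun e _ => hp.nonneg e) (fun e _ => hp.le_one e)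
    have h2 : 0 ≤ ∏ e ∈ τ₂, p e := Finset.prod_nonneg fun e _ => hp.nonneg e
    have := mul_le_mul_of_nonneg_left h1 h2
    linarith
  have hγ₁ : p₁ ≤ ∏ e ∈ τ₁, p e := by
    rw [hp₁def, ← Finset.prod_sdiff hτ₁]
    have h1 : ∏ e ∈ π₁ \ τ₁, p e ≤ 1 :=
      Finset.prod_le_one (fun e _ => hp.nonneg e) (fun e _ => hp.le_one e)
    have h2 : 0 ≤ ∏ e ∈ τ₁, p e := Finset.prod_nonneg fun e _ => hp.nonneg e
    have := mul_le_mul_of_nonneg_left h1 h2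
    linarith
  have hγ₂1 : ∏ e ∈ τ₂, p e ≤ 1 :=
    Finset.prod_le_one (fun e _ => hp.nonneg e) (fun e _ => hp.le_one e)
  have hγ₁1 : ∏ e ∈ τ₁, p e ≤ 1 :=
    Finset.prod_le_one (fun e _ => hp.nonneg e) (fun e _ => hp.le_one e)
  have htb := tail_bound p hp hπ₁ hconn₁ hv₁ htail₂ hsep₂
  have hto := tail_bound p hp hπ₂ hconn₂ hv₂ htail₁ hsep₁
  have hsplit_b := prob_inter_add_prob_inter_compl p (Q ∩ bH) vH
  have hsplit_o := prob_inter_add_prob_inter_compl p (Q ∩ oH) vH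
  -- `d_b (1 − γ₂ p₁) ≤ y (1 − γ₂)`
  have hb' : d_b * (1 - (∏ e ∈ τ₂, p e) * p₁) ≤ y * (1 - ∏ e ∈ τ₂, p e) := by
    rw [← hp₁def] at htb
    linarith [htb, hsplit_b]
  have ho' : d_o * (1 - (∏ e ∈ τ₁, p e) * p₂) ≤ x * (1 - ∏ e ∈ τ₁, p e) := by
    rw [← hp₂def] at hto
    linarith [hto, hsplit_o]
  have hx0 : 0 ≤ x := prob_nonneg hp _
  have hy0 : 0 ≤ y := prob_nonneg hp _
  have hdb0 : 0 ≤ d_b := prob_nonneg hp _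
  have hdo0 : 0 ≤ d_o := prob_nonneg hp _
  have hdby : d_b ≤ y := prob_mono hp Set.inter_subset_left
  have hdox : d_o ≤ x := prob_mono hp Set.inter_subset_left
  have hrb : d_b * (1 - p₁ * p₂) ≤ y * (1 - p₂) :=
    tail_to_route hp₁0 hp₁1 hp₂0 hγ₂ hγ₂1 hy0 hdby hb'
  have hro : d_o * (1 - p₂ * p₁) ≤ x * (1 - p₁) :=
    tail_to_route hp₂0 hp₂1 hp₁0 hγ₁ hγ₁1 hx0 hdox ho'
  have hro' : d_o * (1 - p₁ * p₂) ≤ x * (1 - p₁) := by rw [mul_comm p₁ p₂]; exact hro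
  have hx1 : x ≤ 1 - p₁ := prob_Q_conn_le_one_sub p hp hconn₁ ho a₂
  have hy1 : y ≤ 1 - p₂ := prob_Q_conn_le_one_sub p hp hconn₂ hb a₂
  have halg := two_routes_algebra hp₁0 hp₁1 hp₂0 hp₂1 hx0 hy0 hrb hro' hx1 hy1
  -- assemble `crossC ≥ 0`
  unfold crossC
  rw [hDv, hxv, hyv]
  have k1 : p₂ * y * x₂ ≤ p₂ * y * d_o := mul_le_mul_of_nonneg_left hx₂ (mul_nonneg hp₂0 hy0)
  have k2 : p₁ * x * y₁ ≤ p₁ * x * d_b := mul_le_mul_of_nonneg_left hy₁ (mul_nonneg hp₁0 hx0)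
  linarith [halg, k1, k2]

end Main

section SameRoute

variable {V : Type*} {E : Type*} [Fintype E] [DecidableEq E] [Fintype V] [DecidableEq V]
  {R : Type*} [Field R] [LinearOrder R] [IsStrictOrderedRing R]
variable {ends : E → Sym2 V}

/-- **The two-route class, same-route case `o, b ∈ V₁`: the sign of `crossA′so`**, with
`crossC(c) = p₂·PHI(V₂) + p₁(1 − p₂)·x·y` (`c = p₁ + p₂ − p₁p₂`) and the set-avoidance theorem
`CrossAPrimeAvoidCrux.avoid_crux_nonneg`. -/
theorem crossA'so_nonneg_of_twoRoutes_same (p : E → R) (hp : IsProbVec p) {π₁ π₂ : Finset E}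
    {V₁ V₂ : Finset V} {o a₁ a₂ v b : V}
    (hd : Disjoint π₁ π₂)
    (hπ₂ : ∀ e ∈ π₂, ∀ x, x ∈ ends e → x = a₁ ∨ x ∈ V₂)
    (hconn₁ : ∀ ω ∈ allOpen π₁, ∀ x ∈ V₁, Conn ends ω a₁ x)
    (hconn₂ : ∀ ω ∈ allOpen π₂, ∀ x ∈ V₂, Conn ends ω a₁ x)
    (hv₁ : v ∈ V₁) (hv₂ : v ∈ V₂) (ho : o ∈ V₁) (hb : b ∈ V₁)
    (hroute : ∀ ω ∈ avoidAll ends a₂ {a₁},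
      ω ∈ connEvent ends a₁ v ↔ ω ∈ allOpen π₁ ∪ allOpen π₂) :
    0 ≤ crossA'so p ends o a₁ a₂ v b := by
  classical
  set p₁ := ∏ e ∈ π₁, p e with hp₁def
  set p₂ := ∏ e ∈ π₂, p e with hp₂def
  have hp₁0 : 0 ≤ p₁ := Finset.prod_nonneg fun e _ => hp.nonneg e
  have hp₂0 : 0 ≤ p₂ := Finset.prod_nonneg fun e _ => hp.nonneg e
  have hp₂1 : p₂ ≤ 1 := Finset.prod_le_one (fun e _ => hp.nonneg e) (fun e _ => hp.le_one e)
  have hc : p₁ + p₂ - p₁ * p₂ ≤ prob p (connEvent ends a₁ v) := by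
    rw [← prob_allOpen_union p hd]
    refine prob_mono hp fun ω hω => ?_
    rcases hω with h | h
    · exact hconn₁ ω h v hv₁
    · exact hconn₂ ω h v hv₂
  refine crossA'so_nonneg_of_crossC hp o a₁ a₂ v b hc ?_
  set Q := avoidAll ends a₂ {a₁} with hQ
  set oH := connEvent ends a₂ o
  set bH := connEvent ends a₂ b
  set L := connEvent ends a₁ v
  -- on `Q ∩ {z ∈ K}` with `z ∈ V₁`, the route is `π₂`
  have hred : ∀ z ∈ V₁, Q ∩ (L ∩ connEvent ends a₂ z) = Q ∩ connEvent ends a₂ z ∩ allOpen π₂ := by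
    intro z hz
    ext ω
    simp only [Set.mem_inter_iff]
    constructor
    · rintro ⟨hQω, hL, hzK⟩
      refine ⟨⟨hQω, hzK⟩, ?_⟩
      rcases (hroute ω hQω).1 hL with h | h
      · exact absurd h (not_allOpen_of_mem hconn₁ hz hQω hzK)
      · exact h
    · rintro ⟨⟨hQω, hzK⟩, hπ⟩
      exact ⟨hQω, (hroute ω hQω).2 (Or.inr hπ), hzK⟩
  have hxv : prob p (Q ∩ (L ∩ oH)) = p₂ * prob p (avoidAll ends a₂ (insert a₁ V₂) ∩ oH) := by
    rw [hred o ho]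
    exact prob_Q_conn_allOpen p hπ₂ hconn₂ a₂ o
  have hyv : prob p (Q ∩ (L ∩ bH)) = p₂ * prob p (avoidAll ends a₂ (insert a₁ V₂) ∩ bH) := by
    rw [hred b hb]
    exact prob_Q_conn_allOpen p hπ₂ hconn₂ a₂ b
  have hDv : prob p (Q ∩ (L ∩ (oH ∩ bH))) =
      p₂ * prob p (avoidAll ends a₂ (insert a₁ V₂) ∩ (oH ∩ bH)) := by
    have e1 : Q ∩ (L ∩ (oH ∩ bH)) = Q ∩ (oH ∩ bH) ∩ allOpen π₂ := by
      ext ω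
      simp only [Set.mem_inter_iff]
      constructor
      · rintro ⟨hQω, hL, hoK, hbK⟩
        refine ⟨⟨hQω, hoK, hbK⟩, ?_⟩
        rcases (hroute ω hQω).1 hL with h | h
        · exact absurd h (not_allOpen_of_mem hconn₁ ho hQω hoK)
        · exact h
      · rintro ⟨⟨hQω, hoK, hbK⟩, hπ⟩
        exact ⟨hQω, (hroute ω hQω).2 (Or.inr hπ), hoK, hbK⟩
    rw [e1]
    exact prob_Q_conn_conn_allOpen p hπ₂ hconn₂ a₂ o b
  have hPHI := CrossAPrimeAvoidCrux.avoid_crux_nonneg p hp ends o a₁ a₂ b V₂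
  have hx0 : 0 ≤ prob p (Q ∩ oH) := prob_nonneg hp _
  have hy0 : 0 ≤ prob p (Q ∩ bH) := prob_nonneg hp _
  have hxy := mul_nonneg hx0 hy0
  unfold crossC
  rw [hDv, hxv, hyv]
  have k := mul_nonneg (mul_nonneg hp₁0 (sub_nonneg.2 hp₂1)) hxy
  nlinarith [mul_nonneg hp₂0 hPHI, k]

end SameRoute

end CrossAPrimeTwoRoutes

end Summit.Ventures.PercRepro2
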